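import Summits.QuantumFields.YangMills.Theorems.ColdStartUniversalityLatticeLangevinTimeDecorrelation
import HarnessLib

/-!
# Route `ColdStartUniversality` (fixed-cut-off SZZ dynamics): ★★★ MEAN-SQUARE ERGODIC THEOREM FOR THE COLD-START LANGEVIN SAMPLER —
# `E[(T⁻¹∫₀ᵀ G(U_r) dr − μ_(β')(G))²] ≤ 4C/(c·T)`, every coupling, every start, every bounded measurable `G`

Helper file (seat `ym-line-csu-p1`, g33; `--supports stmt-QuantumFields-24809`).  The time-like decorrelation of file 48
(`abs_twoTime_centered_le_exp`: `|E[F(U_s)(G(U_(s+t)) − μG)]| ≤ C e^(−ct)`) makes the variance of TIME AVERAGES along a strong solution of the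
SU(2) SZZ dynamics summable: for every jointly measurable strong solution `U` from a deterministic start on ANY probability space (in particular the
cold start of the route), every bounded measurable `G` with `|G| ≤ 1` and every `T > 0`,

  `E[(T⁻¹ ∫₀ᵀ G(U_r) dr − ∫ G dμ_(β'))²] ≤ 4C/(c·T)`     (`integral_sq_timeAverage_sub_wilson_le`),

i.e. the Langevin simulation started anywhere computes Gibbs expectations with mean-square error `O(1/√T)` — the `L²` ergodic theorem with rate
for the process (not only for its one-time laws: the Cesàro statements of the tree, e.g. `wilson_coldStart_cesaro_allCoupling_explicit`, average
EXPECTATIONS; here the PATHWISE time average is controlled).  Ingredients: a general variance lemma for time integrals of a jointly measurable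
bounded random field with exponentially decaying two-time products (`integral_sq_setIntegral_le_of_twoTime`, Fubini on `Ω × [0,T]²` and
`∫ e^(−c|u|) du = 2/c`, `integral_exp_neg_mul_abs`), and file 48.  Constants `C, c > 0` depend on `L, β'` (Harris at fixed cut-off).  THEOREMS ONLY, no definition, no sorry;
[folklore].  HONEST FRAMING: fixed cut-off, volume-dependent constants; `UniformColdStartMixing` (24809) is NOT restated; no crux, rung or summit
statement is proved; the Yang–Mills mass gap is NOT proved.
-/

set_option autoImplicit false

noncomputable section

namespace Summit.QuantumFields.YangMills.Theorems.ColdStartUniversality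

open MeasureTheory ProbabilityTheory Filter Topology Set
open scoped NNReal ENNReal BigOperators
open Literature Literature.Probability.Process Literature.MathematicalPhysics.QuantumFieldTheory
open Literature.MathematicalPhysics.QuantumLattice (fundamentalRep fundamentalLatticeRep continuous_fundamentalRep)

/-! ## §1. `∫ e^(−c|u|) du = 2/c` and a translated set-integral bound -/

/-- `∫ e^(−c|u|) du = 2/c` for `c > 0`. [folklore] -/
theorem integral_exp_neg_mul_abs {c : ℝ} (hc : 0 < c) : ∫ u : ℝ, Real.exp (-c * |u|) = 2 / c := by
  rw [integral_comp_abs (f := fun u => Real.exp (-c * u)), integral_exp_mul_Ioi (neg_lt_zero.2 hc) 0]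
  field_simp
  simp

/-- For every set `S ⊆ ℝ` and centre `r`: `∫_S e^(−c|r'−r|) dr' ≤ 2/c`. [folklore] -/
theorem setIntegral_exp_neg_mul_abs_sub_le {c : ℝ} (hc : 0 < c) (S : Set ℝ) (r : ℝ) :
    ∫ r' in S, Real.exp (-c * |r' - r|) ≤ 2 / c := by
  -- `u ↦ e^(−c|u|)` is integrable (cf. `Literature.Analysis.SpecialFunctions.integrable_exp_neg_mul_abs`, not imported here)
  have hI : Integrable fun u : ℝ => Real.exp (-c * |u|) := by
    have h1 : IntegrableOn (fun u : ℝ => Real.exp (-c * |u|)) (Ioi 0) :=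
      (integrableOn_congr_fun (fun u (hu : u ∈ Ioi 0) => by rw [abs_of_pos (mem_Ioi.1 hu)]) measurableSet_Ioi).2
        (integrableOn_exp_mul_Ioi (neg_lt_zero.2 hc) 0)
    have h2 : IntegrableOn (fun u : ℝ => Real.exp (-c * |u|)) (Iic 0) :=
      (integrableOn_congr_fun (fun u (hu : u ∈ Iic 0) => by
        rw [abs_of_nonpos (mem_Iic.1 hu)]; ring_nf) measurableSet_Iic).2 (integrableOn_exp_mul_Iic hc 0)
    have h := h2.union h1
    rwa [Iic_union_Ioi, integrableOn_univ] at h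
  have hint : Integrable fun r' : ℝ => Real.exp (-c * |r' - r|) := hI.comp_sub_right r
  calc ∫ r' in S, Real.exp (-c * |r' - r|) ≤ ∫ r' : ℝ, Real.exp (-c * |r' - r|) :=
        setIntegral_le_integral hint (Eventually.of_forall fun r' => (Real.exp_pos _).le)
    _ = ∫ u : ℝ, Real.exp (-c * |u|) := integral_sub_right_eq_self (fun u => Real.exp (-c * |u|)) r
    _ = 2 / c := integral_exp_neg_mul_abs hc

/-! ## §2. Variance of time integrals of a bounded random field with exponentially decaying two-time products -/

/-- **Variance lemma for time integrals.**  Let `g : ℝ → Ω → ℝ` be jointly measurable with `|g| ≤ B`, and suppose the two-time products decay: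
`|E[g(r)·g(r')]| ≤ K·e^(−c|r'−r|)` for all `r, r' ∈ (0, T]`.  Then `E[(∫_(0,T] g(r) dr)²] ≤ K·(2/c)·T`. (Fubini on `Ω × (0,T]²`.) [folklore] -/
theorem integral_sq_setIntegral_le_of_twoTime {Ω : Type*} [MeasurableSpace Ω] {P : Measure Ω} [IsProbabilityMeasure P]
    {g : ℝ → Ω → ℝ} (hg : Measurable (Function.uncurry g)) {B : ℝ} (hB : ∀ r ω, |g r ω| ≤ B)
    {T : ℝ} (hT : 0 ≤ T) {K c : ℝ} (hK : 0 ≤ K) (hc : 0 < c)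
    (hdec : ∀ r ∈ Ioc 0 T, ∀ r' ∈ Ioc 0 T, |∫ ω, g r ω * g r' ω ∂P| ≤ K * Real.exp (-c * |r' - r|)) :
    ∫ ω, (∫ r in Ioc 0 T, g r ω) ^ 2 ∂P ≤ K * (2 / c) * T := by
  set ν : Measure ℝ := volume.restrict (Ioc 0 T) with hν
  haveI : IsFiniteMeasure ν := isFiniteMeasure_restrict.2 measure_Ioc_lt_top.ne
  have hνT : ν.real univ = T := by
    rw [hν, measureReal_restrict_apply_univ, Real.volume_real_Ioc_of_le hT, sub_zero]
  -- the square of the time integral as a double integral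
  have hsq : ∀ ω, (∫ r in Ioc 0 T, g r ω) ^ 2 = ∫ z, g z.1 ω * g z.2 ω ∂(ν.prod ν) := fun ω => by
    rw [sq, ← integral_prod_mul (μ := ν) (ν := ν) (fun r => g r ω) (fun r => g r ω)]
  -- joint measurability and integrability on `Ω × (ℝ × ℝ)`
  have hm1 : Measurable fun q : Ω × (ℝ × ℝ) => g q.2.1 q.1 := hg.comp ((measurable_fst.comp measurable_snd).prodMk measurable_fst)
  have hm2 : Measurable fun q : Ω × (ℝ × ℝ) => g q.2.2 q.1 := hg.comp ((measurable_snd.comp measurable_snd).prodMk measurable_fst)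
  have hmH : Measurable fun q : Ω × (ℝ × ℝ) => g q.2.1 q.1 * g q.2.2 q.1 := hm1.mul hm2
  have hHb : ∀ q : Ω × (ℝ × ℝ), ‖g q.2.1 q.1 * g q.2.2 q.1‖ ≤ B * B := fun q => by
    rw [norm_mul, Real.norm_eq_abs, Real.norm_eq_abs]
    exact mul_le_mul (hB _ _) (hB _ _) (abs_nonneg _) ((abs_nonneg _).trans (hB q.2.1 q.1))
  have hInt : Integrable (Function.uncurry fun (ω : Ω) (z : ℝ × ℝ) => g z.1 ω * g z.2 ω) (P.prod (ν.prod ν)) :=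
    (integrable_const (B * B)).mono' hmH.aestronglyMeasurable (Eventually.of_forall fun q => hHb q)
  -- Fubini
  have hswap : ∫ ω, (∫ z, g z.1 ω * g z.2 ω ∂(ν.prod ν)) ∂P = ∫ z, (∫ ω, g z.1 ω * g z.2 ω ∂P) ∂(ν.prod ν) :=
    integral_integral_swap hInt
  rw [integral_congr_ae (ae_of_all _ hsq), hswap]
  -- bound the two-time products, then integrate the exponential kernel
  have hEm : ∀ z : ℝ × ℝ, ‖∫ ω, g z.1 ω * g z.2 ω ∂P‖ ≤ B * B := fun z => by
    have hh := norm_integral_le_of_norm_le_const (μ := P) (f := fun ω => g z.1 ω * g z.2 ω) (C := B * B)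
      (Eventually.of_forall fun ω => hHb (ω, z))
    simpa using hh
  have hle : ∀ᵐ z ∂(ν.prod ν), (∫ ω, g z.1 ω * g z.2 ω ∂P) ≤ K * Real.exp (-c * |z.2 - z.1|) := by
    have hνmem : ∀ᵐ r ∂ν, r ∈ Ioc 0 T := by rw [hν]; exact ae_restrict_mem measurableSet_Ioc
    have h1 : ∀ᵐ z ∂(ν.prod ν), z.1 ∈ Ioc 0 T :=
      (Measure.quasiMeasurePreserving_fst (μ := ν) (ν := ν)).ae hνmem
    have h2 : ∀ᵐ z ∂(ν.prod ν), z.2 ∈ Ioc 0 T :=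
      (Measure.quasiMeasurePreserving_snd (μ := ν) (ν := ν)).ae hνmem
    filter_upwards [h1, h2] with z hz1 hz2
    exact (le_abs_self _).trans (hdec z.1 hz1 z.2 hz2)
  have hKi : Integrable (fun z : ℝ × ℝ => K * Real.exp (-c * |z.2 - z.1|)) (ν.prod ν) := by
    refine (integrable_const (|K| * 1)).mono' ?_ (Eventually.of_forall fun z => ?_)
    · exact ((measurable_const.mul ((measurable_snd.sub measurable_fst).abs.const_mul _).exp)).aestronglyMeasurable
    · rw [norm_mul, Real.norm_eq_abs, Real.norm_eq_abs, abs_of_pos (Real.exp_pos _)]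
      refine mul_le_mul_of_nonneg_left ?_ (abs_nonneg K)
      rw [Real.exp_le_one_iff]
      nlinarith [abs_nonneg (z.2 - z.1)]
  have hEi : Integrable (fun z : ℝ × ℝ => ∫ ω, g z.1 ω * g z.2 ω ∂P) (ν.prod ν) := hInt.integral_prod_right
  calc ∫ z, (∫ ω, g z.1 ω * g z.2 ω ∂P) ∂(ν.prod ν) ≤ ∫ z, K * Real.exp (-c * |z.2 - z.1|) ∂(ν.prod ν) :=
        integral_mono_ae hEi hKi hle
    _ = ∫ r, (∫ r', K * Real.exp (-c * |r' - r|) ∂ν) ∂ν := integral_prod _ hKi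
    _ ≤ ∫ _r, K * (2 / c) ∂ν := by
        refine integral_mono_of_nonneg ?_ (integrable_const _) (ae_of_all _ fun r => ?_)
        · exact ae_of_all _ fun r => integral_nonneg fun r' => mul_nonneg hK (Real.exp_pos _).le
        · show (∫ r', K * Real.exp (-c * |r' - r|) ∂ν) ≤ K * (2 / c)
          rw [integral_const_mul, hν]
          exact mul_le_mul_of_nonneg_left (setIntegral_exp_neg_mul_abs_sub_le hc _ r) hK
    _ = K * (2 / c) * T := by rw [integral_const, smul_eq_mul, hνT]; ring

/-- **Normalised form**: under the hypotheses of `integral_sq_setIntegral_le_of_twoTime` and `T > 0`,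
`E[(T⁻¹ ∫_(0,T] g(r) dr)²] ≤ 2K/(c·T)`. [folklore] -/
theorem integral_sq_timeAverage_le_of_twoTime {Ω : Type*} [MeasurableSpace Ω] {P : Measure Ω} [IsProbabilityMeasure P]
    {g : ℝ → Ω → ℝ} (hg : Measurable (Function.uncurry g)) {B : ℝ} (hB : ∀ r ω, |g r ω| ≤ B)
    {T : ℝ} (hT : 0 < T) {K c : ℝ} (hK : 0 ≤ K) (hc : 0 < c)
    (hdec : ∀ r ∈ Ioc 0 T, ∀ r' ∈ Ioc 0 T, |∫ ω, g r ω * g r' ω ∂P| ≤ K * Real.exp (-c * |r' - r|)) :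
    ∫ ω, (T⁻¹ * ∫ r in Ioc 0 T, g r ω) ^ 2 ∂P ≤ 2 * K / (c * T) := by
  have h := integral_sq_setIntegral_le_of_twoTime hg hB hT.le hK hc hdec
  have hT2 : 0 < T ^ 2 := by positivity
  calc ∫ ω, (T⁻¹ * ∫ r in Ioc 0 T, g r ω) ^ 2 ∂P = T⁻¹ ^ 2 * ∫ ω, (∫ r in Ioc 0 T, g r ω) ^ 2 ∂P := by
        rw [← integral_const_mul]
        exact integral_congr_ae (ae_of_all _ fun ω => by ring)
    _ ≤ T⁻¹ ^ 2 * (K * (2 / c) * T) := mul_le_mul_of_nonneg_left h (by positivity)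
    _ = 2 * K / (c * T) := by field_simp

/-! ## §3. The mean-square ergodic theorem along every strong solution -/

variable {L : ℕ} [NeZero L]

/-- ★★★ **MEAN-SQUARE ERGODIC THEOREM for the cold-start Langevin sampler** (every coupling; `C, c` depend on `L, β'`): there are `C, c > 0` such
that for EVERY jointly measurable strong solution `U` of the SU(2) SZZ dynamics from a deterministic start on ANY probability space, every bounded
measurable `G` with `|G| ≤ 1` and every `T > 0`:
`E[(T⁻¹ ∫_(0,T] G(U_r) dr − ∫ G dμ_(β'))²] ≤ 4C/(c·T)` — the time average of the simulation converges to the Gibbs expectation in mean square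
at rate `O(1/√T)`, from every start. [folklore] -/
theorem integral_sq_timeAverage_sub_wilson_le (L : ℕ) [NeZero L] (β' : ℝ) :
    ∃ C c : ℝ, 0 < C ∧ 0 < c ∧
      ∀ (x : GaugeConfig 3 L (Matrix.specialUnitaryGroup (Fin 2) ℂ))
        (Ω : Type) [MeasurableSpace Ω] (P : Measure Ω) [IsProbabilityMeasure P]
        (W : ℝ≥0 → Ω → (Edge 3 L × NoiseIdx 2 → ℝ)) (hW : IsFlatBrownian W P)
        (U : ℝ≥0 → Ω → GaugeConfig 3 L (Matrix.specialUnitaryGroup (Fin 2) ℂ)),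
        (∀ ω, U 0 ω = x) →
        (latticeLangevinDynamics (fundamentalLatticeRep 2) β').IsSolution (fundamentalRep (Fin 2)) hW.natFiltration P W U →
        Measurable (Function.uncurry U) →
        ∀ (G : GaugeConfig 3 L (Matrix.specialUnitaryGroup (Fin 2) ℂ) → ℝ), Measurable G → (∀ z, |G z| ≤ 1) →
        ∀ (T : ℝ), 0 < T →
          ∫ ω, (T⁻¹ * (∫ r in Ioc 0 T, G (U r.toNNReal ω)) - ∫ z, G z ∂(wilsonMeasure (d := 3) (L := L) (fundamentalRep (Fin 2)) β')) ^ 2 ∂P ≤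
            4 * C / (c * T) := by
  classical
  obtain ⟨C, c, hC, hc, h⟩ := abs_twoTime_centered_le_exp L β'
  refine ⟨C, c, hC, hc, fun x Ω _ P _ W hW U hU0 hU hUj G hG hG1 T hT => ?_⟩
  haveI : IsProbabilityMeasure (wilsonMeasure (d := 3) (L := L) (fundamentalRep (Fin 2)) β') :=
    isProbabilityMeasure_wilsonMeasure (d := 3) (L := L) (fundamentalRep (Fin 2)) (continuous_fundamentalRep (Fin 2)) β'
  set m : ℝ := ∫ z, G z ∂(wilsonMeasure (d := 3) (L := L) (fundamentalRep (Fin 2)) β') with hm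
  have hm1 : |m| ≤ 1 := by
    have hh := norm_integral_le_of_norm_le_const (μ := wilsonMeasure (d := 3) (L := L) (fundamentalRep (Fin 2)) β') (f := G) (C := 1)
      (Eventually.of_forall fun z => by simpa [Real.norm_eq_abs] using hG1 z)
    simpa [Real.norm_eq_abs] using hh
  -- the centred field `g r ω = G(U_r ω) − m`, jointly measurable, `|g| ≤ 2`
  set g : ℝ → Ω → ℝ := fun r ω => G (U r.toNNReal ω) - m with hgdef
  have hgm : Measurable (Function.uncurry g) := by
    have h1 : Measurable fun q : ℝ × Ω => U q.1.toNNReal q.2 :=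
      hUj.comp ((measurable_real_toNNReal.comp measurable_fst).prodMk measurable_snd)
    exact (hG.comp h1).sub measurable_const
  have hgb : ∀ r ω, |g r ω| ≤ 2 := fun r ω => by
    show |G (U r.toNNReal ω) - m| ≤ 2
    calc |G (U r.toNNReal ω) - m| ≤ |G (U r.toNNReal ω)| + |m| := abs_sub _ _
      _ ≤ 1 + 1 := add_le_add (hG1 _) hm1
      _ = 2 := by norm_num
  -- two-time decay from file 48, both time orders
  have hF : Measurable fun z => (G z - m) / 2 := (hG.sub measurable_const).div_const 2
  have hF1 : ∀ z, |(G z - m) / 2| ≤ 1 := fun z => by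
    rw [abs_div, abs_two]
    have : |G z - m| ≤ 2 := (abs_sub _ _).trans (by linarith [hG1 z, hm1])
    linarith
  have hord : ∀ r r' : ℝ, 0 ≤ r → r ≤ r' → |∫ ω, g r ω * g r' ω ∂P| ≤ 2 * C * Real.exp (-c * |r' - r|) := by
    intro r r' hr hrr'
    have ht : r'.toNNReal = r.toNNReal + (r' - r).toNNReal := by
      rw [← Real.toNNReal_add hr (sub_nonneg.2 hrr')]; congr 1; ring
    have h1 := h x Ω P W hW U hU0 hU r.toNNReal (r' - r).toNNReal (fun z => (G z - m) / 2) G hF hF1 hG hG1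
    rw [← ht] at h1
    have heq : ∫ ω, g r ω * g r' ω ∂P = 2 * ∫ ω, (G (U r.toNNReal ω) - m) / 2 * (G (U r'.toNNReal ω) - m) ∂P := by
      rw [← integral_const_mul]
      exact integral_congr_ae (ae_of_all _ fun ω => by simp only [hgdef]; ring)
    rw [Real.coe_toNNReal _ (sub_nonneg.2 hrr')] at h1
    rw [heq, abs_mul, abs_two, abs_of_nonneg (sub_nonneg.2 hrr')]
    calc 2 * |∫ ω, (G (U r.toNNReal ω) - m) / 2 * (G (U r'.toNNReal ω) - m) ∂P| ≤ 2 * (C * Real.exp (-c * (r' - r))) :=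
          mul_le_mul_of_nonneg_left h1 (by norm_num)
      _ = 2 * C * Real.exp (-c * (r' - r)) := by ring
  have hdec : ∀ r ∈ Ioc 0 T, ∀ r' ∈ Ioc 0 T, |∫ ω, g r ω * g r' ω ∂P| ≤ 2 * C * Real.exp (-c * |r' - r|) := by
    intro r hr r' hr'
    rcases le_total r r' with hle | hle
    · exact hord r r' hr.1.le hle
    · have hs := hord r' r hr'.1.le hle
      have hcomm : ∫ ω, g r ω * g r' ω ∂P = ∫ ω, g r' ω * g r ω ∂P := integral_congr_ae (ae_of_all _ fun ω => mul_comm _ _)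
      rw [hcomm, abs_sub_comm]
      exact hs
  -- the variance lemma
  have hvar := integral_sq_timeAverage_le_of_twoTime hgm hgb hT (by positivity : (0 : ℝ) ≤ 2 * C) hc hdec
  -- `T⁻¹ ∫ G(U_r) dr − m = T⁻¹ ∫ (G(U_r) − m) dr`
  haveI : IsFiniteMeasure (volume.restrict (Ioc (0 : ℝ) T)) := isFiniteMeasure_restrict.2 measure_Ioc_lt_top.ne
  have hmU : ∀ u : ℝ≥0, Measurable (U u) := fun u => (hU.adapted u).mono (hW.natFiltration.le u) le_rfl
  have hcent : ∀ ω, T⁻¹ * (∫ r in Ioc 0 T, G (U r.toNNReal ω)) - m = T⁻¹ * ∫ r in Ioc 0 T, g r ω := by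
    intro ω
    have hUr : Measurable fun r : ℝ => U r.toNNReal ω := hUj.comp (measurable_real_toNNReal.prodMk measurable_const)
    have hGi : Integrable (fun r : ℝ => G (U r.toNNReal ω)) (volume.restrict (Ioc 0 T)) :=
      (integrable_const (1 : ℝ)).mono' (hG.comp hUr).aestronglyMeasurable
        (Eventually.of_forall fun r => by simpa [Real.norm_eq_abs] using hG1 (U r.toNNReal ω))
    have hsub : ∫ r in Ioc 0 T, g r ω = (∫ r in Ioc 0 T, G (U r.toNNReal ω)) - T * m := by
      show ∫ r in Ioc 0 T, (G (U r.toNNReal ω) - m) = _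
      rw [integral_sub hGi (integrable_const m), integral_const, smul_eq_mul, measureReal_restrict_apply_univ,
        Real.volume_real_Ioc_of_le hT.le, sub_zero]
    rw [hsub, mul_sub, ← mul_assoc, inv_mul_cancel₀ hT.ne', one_mul]
  calc ∫ ω, (T⁻¹ * (∫ r in Ioc 0 T, G (U r.toNNReal ω)) - m) ^ 2 ∂P = ∫ ω, (T⁻¹ * ∫ r in Ioc 0 T, g r ω) ^ 2 ∂P :=
        integral_congr_ae (ae_of_all _ fun ω => by simp only [hcent ω])
    _ ≤ 2 * (2 * C) / (c * T) := hvar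
    _ = 4 * C / (c * T) := by ring

end Summit.QuantumFields.YangMills.Theorems.ColdStartUniversality

end
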